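import Summits.QuantumFields.YangMills.Theorems.DirichletWindowAllSidesChessboardEvenWalk
import HarnessLib

/-!
# The twisted two-class chessboard estimate on a block torus of EVEN side — the estimate

Support file for item stmt-QuantumFields-20194 (`DirichletWindow.AllSidesCouplingChessboard`, K1 of the large-field
sparsity line; seat ym-dw-p1 g3).  Final part of the even-side abstract estimate (`…EvenCore`, `…EvenTranslate`,
`…EvenWalk`).

For a family `A = (A_o)_{o ∈ O}` of sets of blocks of the even torus `(ℤ/N)^d` and an axis `i`, the components are of
two kinds (`cls i o`: slab-type, else layer-type).  The LINK pair of the boundary `k` symmetrises layer-type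
components with the tree's open symmetrisations `symP/symM i k` and slab-type components with the site-type closed
symmetrisations `ssymP/ssymM i (k-1)`; the SITE pair through `k` symmetrises layer-type components with
`ssymP/ssymM i k` and slab-type ones with `symP/symM i k`.  If a functional `ψ ≥ 0` with `ψ ⊤ > 0` obeys the reflection
Cauchy–Schwarz inequality for every LINK pair and every SITE pair of every axis, and `ψ (cylinder over T) ≤ ψ ⊤ ^ #T`,
then `ψ A ^ (N^d) ≤ ψ ⊤ ^ (∑_o #(A o))` (`twisted_chessboard_pow_le_even`) and `ψ A ≤ ψ ⊤ ^ (size A / N^d)`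
(`twisted_chessboard_le_rpow_even`); for a translation-invariant `ψ` the two BASE pairs (link `k = 1`, site `k = 0`)
suffice (`twisted_chessboard_le_rpow_even_of_base`).  Maximisation argument of Fröhlich–Israel–Lieb–Simon with the
two-phase open walk of `…EvenWalk`; finite combinatorics and real arithmetic only.

References: J. Fröhlich, R. Israel, E. H. Lieb, B. Simon, Comm. Math. Phys. 62 (1978) 1–34, Thm. 2.2/4.1; J. Fröhlich,
E. H. Lieb, Comm. Math. Phys. 60 (1978) 233–267, Thm. 2.2/2.3.  Nothing here is a statement about the Yang–Mills gap.
-/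

noncomputable section

open Finset
open Literature.Barriers.CriticalPhenomena.NonGibbs
open Literature.Probability.LatticeModels

namespace Summit.QuantumFields.YangMills.Theorems.AllSidesChessboard


/-! ### §4. The twisted chessboard estimate for even sides -/

section Main

variable {d N : ℕ} [NeZero N] {O : Type*} [Fintype O] [DecidableEq O] (cls : Fin d → O → Bool)

/-- **The twisted two-class chessboard estimate, power form, on the block torus of EVEN side.**  A functional `ψ ≥ 0`
on families of sets of blocks of `(ℤ/N)^d`, `N` even, with `ψ ⊤ > 0`, bounded on cylinders by `ψ (cyl T) ≤ ψ ⊤ ^ #T`,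
obeying for every axis `i` and every `k` the LINK-pair and the SITE-pair reflection Cauchy–Schwarz inequalities,
satisfies `ψ A ^ (N^d) ≤ ψ ⊤ ^ (∑_o #(A o))`. -/
theorem twisted_chessboard_pow_le_even (hN : Even N) {ψ : (O → Finset (BlockIdx d N)) → ℝ}
    (h0 : ∀ A, 0 ≤ ψ A) (h1 : 0 < ψ fun _ => univ)
    (hlink : ∀ (i : Fin d) (k : ZMod N) (A : O → Finset (BlockIdx d N)),
      ψ A ^ 2 ≤ ψ (fun o => if cls i o then ssymP i (k - 1) (A o) else symP i k (A o)) *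
        ψ (fun o => if cls i o then ssymM i (k - 1) (A o) else symM i k (A o)))
    (hsite : ∀ (i : Fin d) (k : ZMod N) (A : O → Finset (BlockIdx d N)),
      ψ A ^ 2 ≤ ψ (fun o => if cls i o then symP i k (A o) else ssymP i k (A o)) *
        ψ (fun o => if cls i o then symM i k (A o) else ssymM i k (A o)))
    (hcyl : ∀ T : Finset O, ψ (fun o => if o ∈ T then univ else ∅) ≤ (ψ fun _ => univ) ^ #T)
    (A : O → Finset (BlockIdx d N)) :
    ψ A ^ (N ^ d) ≤ (ψ fun _ => univ) ^ (∑ o, #(A o)) := by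
  classical
  obtain ⟨Amax, -, hAmax⟩ := Finset.exists_max_image (univ : Finset (O → Finset (BlockIdx d N)))
    (ePhi ψ) ⟨A, mem_univ _⟩
  set M := ePhi ψ Amax with hM
  have hmax : ∀ B, ePhi ψ B ≤ M := fun B => hAmax B (mem_univ B)
  have hden : 0 < (ψ fun _ => univ) ^ (∑ o, #(A o)) := pow_pos h1 _
  by_cases hMpos : M ≤ 0
  · have h := (hmax A).trans hMpos
    rw [ePhi, div_le_iff₀ hden, zero_mul] at h
    exact h.trans (pow_nonneg h1.le _)
  rw [not_le] at hMpos
  have grow : ∀ m : ℕ, m ≤ d → ∃ A' : O → Finset (BlockIdx d N), ePhi ψ A' = M ∧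
      ∀ j : Fin d, j.val < m → ∀ o, ∀ c ∈ A' o, ∀ t : ZMod N, Function.update c j t ∈ A' o := by
    intro m
    induction m with
    | zero => exact fun _ => ⟨Amax, rfl, fun j hj => absurd hj (Nat.not_lt_zero _)⟩
    | succ m ih =>
      intro hm
      obtain ⟨A₁, hA₁, hcyl₁⟩ := ih (Nat.le_of_succ_le hm)
      have hi : m < d := hm
      obtain ⟨A₂, ⟨hA₂, hcyl₂⟩, hcyl₂'⟩ := exists_cyl_of_stable_even cls hN
        (P := fun B => ePhi ψ B = M ∧
          ∀ j : Fin d, j.val < m → ∀ o, ∀ c ∈ B o, ∀ t : ZMod N, Function.update c j t ∈ B o)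
        ⟨m, hi⟩
        (fun k B ⟨hB, hBc⟩ => ⟨ePhi_eq_of_isMax_of_pair ψ h0 h1 (hlink ⟨m, hi⟩ k B)
            (size_link_pair cls hN ⟨m, hi⟩ k B) hMpos hmax hB,
          fun j hj o => by
            have hji : j ≠ ⟨m, hi⟩ := fun h => by rw [h] at hj; exact lt_irrefl _ hj
            dsimp only
            split_ifs
            · exact cyl_ssymP hji (k - 1) (hBc j hj o)
            · exact cyl_symP hji k (hBc j hj o)⟩)
        (fun k B ⟨hB, hBc⟩ => ⟨ePhi_eq_of_isMax_of_pair ψ h0 h1 (hsite ⟨m, hi⟩ k B)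
            (size_site_pair cls hN ⟨m, hi⟩ k B) hMpos hmax hB,
          fun j hj o => by
            have hji : j ≠ ⟨m, hi⟩ := fun h => by rw [h] at hj; exact lt_irrefl _ hj
            dsimp only
            split_ifs
            · exact cyl_symP hji k (hBc j hj o)
            · exact cyl_ssymP hji k (hBc j hj o)⟩)
        (A := A₁) ⟨hA₁, hcyl₁⟩
      refine ⟨A₂, hA₂, fun j hj o => ?_⟩
      by_cases hjm : j.val < m
      · exact hcyl₂ j hjm o
      · have : j = ⟨m, hi⟩ := Fin.ext (by show j.val = m; omega)
        subst this
        exact hcyl₂' o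
  obtain ⟨A', hA', hcylA⟩ := grow d le_rfl
  have hdich : ∀ o, A' o = ∅ ∨ A' o = univ := by
    intro o
    by_cases he : A' o = ∅
    · exact Or.inl he
    · obtain ⟨c₀, hc₀⟩ := Finset.nonempty_iff_ne_empty.2 he
      exact Or.inr (eq_univ_of_forall_cyl (fun j => hcylA j j.isLt o) hc₀)
  obtain ⟨T, hT⟩ : ∃ T : Finset O, A' = fun o => if o ∈ T then univ else ∅ := by
    refine ⟨univ.filter fun o => A' o = univ, funext fun o => ?_⟩
    by_cases ho : A' o = univ
    · rw [if_pos (show o ∈ univ.filter (fun o => A' o = univ) from mem_filter.2 ⟨mem_univ o, ho⟩), ho]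
    · rw [if_neg (show o ∉ univ.filter (fun o => A' o = univ) from fun h => ho (mem_filter.1 h).2)]
      exact (hdich o).resolve_right ho
  subst hT
  have hcardU : #(univ : Finset (BlockIdx d N)) = N ^ d := by
    rw [card_univ, Fintype.card_fun, ZMod.card, Fintype.card_fin]
  have hsize : ∑ o, #((fun o => if o ∈ T then (univ : Finset (BlockIdx d N)) else ∅) o) = #T * N ^ d := by
    simp_rw [apply_ite Finset.card, hcardU, card_empty]
    rw [Finset.sum_ite_mem, univ_inter, sum_const, smul_eq_mul]
  have hMle : M ≤ 1 := by
    rw [← hA', ePhi, hsize, div_le_one (pow_pos h1 _), pow_mul]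
    exact pow_le_pow_left₀ (h0 _) (hcyl T) _
  have h := (hmax A).trans hMle
  rw [ePhi, div_le_one hden] at h
  exact h

/-- **The twisted two-class chessboard estimate for even sides**, usual form `ψ A ≤ ψ ⊤ ^ ((∑_o #(A o)) / N^d)`. -/
theorem twisted_chessboard_le_rpow_even (hN : Even N) {ψ : (O → Finset (BlockIdx d N)) → ℝ}
    (h0 : ∀ A, 0 ≤ ψ A) (h1 : 0 < ψ fun _ => univ)
    (hlink : ∀ (i : Fin d) (k : ZMod N) (A : O → Finset (BlockIdx d N)),
      ψ A ^ 2 ≤ ψ (fun o => if cls i o then ssymP i (k - 1) (A o) else symP i k (A o)) *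
        ψ (fun o => if cls i o then ssymM i (k - 1) (A o) else symM i k (A o)))
    (hsite : ∀ (i : Fin d) (k : ZMod N) (A : O → Finset (BlockIdx d N)),
      ψ A ^ 2 ≤ ψ (fun o => if cls i o then symP i k (A o) else ssymP i k (A o)) *
        ψ (fun o => if cls i o then symM i k (A o) else ssymM i k (A o)))
    (hcyl : ∀ T : Finset O, ψ (fun o => if o ∈ T then univ else ∅) ≤ (ψ fun _ => univ) ^ #T)
    (A : O → Finset (BlockIdx d N)) :
    ψ A ≤ (ψ fun _ => univ) ^ (((∑ o, #(A o) : ℕ) : ℝ) / (N : ℝ) ^ d) := by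
  have hNd : (0 : ℝ) < (N : ℝ) ^ d := by
    have : (0 : ℝ) < N := by exact_mod_cast Nat.pos_of_ne_zero (NeZero.ne N)
    positivity
  have h := twisted_chessboard_pow_le_even cls hN h0 h1 hlink hsite hcyl A
  have hroot : ψ A = (ψ A ^ (N ^ d)) ^ ((1 : ℝ) / (N : ℝ) ^ d) := by
    rw [← Real.rpow_natCast, ← Real.rpow_mul (h0 A)]
    push_cast
    rw [mul_one_div_cancel hNd.ne', Real.rpow_one]
  rw [hroot]
  calc (ψ A ^ N ^ d) ^ ((1 : ℝ) / (N : ℝ) ^ d)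
      ≤ ((ψ fun _ => univ) ^ (∑ o, #(A o))) ^ ((1 : ℝ) / (N : ℝ) ^ d) :=
        Real.rpow_le_rpow (pow_nonneg (h0 A) _) h (by positivity)
    _ = (ψ fun _ => univ) ^ (((∑ o, #(A o) : ℕ) : ℝ) / (N : ℝ) ^ d) := by
        rw [← Real.rpow_natCast, ← Real.rpow_mul h1.le]
        congr 1
        ring

/-- **Base reflections suffice for a translation-invariant functional.**  If `ψ` is invariant under the diagonal
block translations of every axis, the LINK pair of the boundary `k = 1` and the SITE pair through `k = 0` of every
axis give the pairs for every `k`, hence the estimate. -/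
theorem twisted_chessboard_le_rpow_even_of_base (hN : Even N) {ψ : (O → Finset (BlockIdx d N)) → ℝ}
    (h0 : ∀ A, 0 ≤ ψ A) (h1 : 0 < ψ fun _ => univ)
    (htr : ∀ (i : Fin d) (a : ZMod N) (A : O → Finset (BlockIdx d N)),
      ψ (fun o => (A o).image (cellTranslate i a)) = ψ A)
    (hlink : ∀ (i : Fin d) (A : O → Finset (BlockIdx d N)),
      ψ A ^ 2 ≤ ψ (fun o => if cls i o then ssymP i 0 (A o) else symP i 1 (A o)) *
        ψ (fun o => if cls i o then ssymM i 0 (A o) else symM i 1 (A o)))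
    (hsite : ∀ (i : Fin d) (A : O → Finset (BlockIdx d N)),
      ψ A ^ 2 ≤ ψ (fun o => if cls i o then symP i 0 (A o) else ssymP i 0 (A o)) *
        ψ (fun o => if cls i o then symM i 0 (A o) else ssymM i 0 (A o)))
    (hcyl : ∀ T : Finset O, ψ (fun o => if o ∈ T then univ else ∅) ≤ (ψ fun _ => univ) ^ #T)
    (A : O → Finset (BlockIdx d N)) :
    ψ A ≤ (ψ fun _ => univ) ^ (((∑ o, #(A o) : ℕ) : ℝ) / (N : ℝ) ^ d) := by
  refine twisted_chessboard_le_rpow_even cls hN h0 h1 (fun i k A => ?_) (fun i k A => ?_) hcyl A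
  · -- LINK pair at `k` = translate by `k - 1` of the LINK pair at `1` of the translated family
    set a : ZMod N := k - 1 with ha
    set A' : O → Finset (BlockIdx d N) := fun o => (A o).image (cellTranslate i (-a)) with hA'
    have hback : ∀ o, (A' o).image (cellTranslate i a) = A o := fun o => by
      rw [hA']; simpa using image_cellTranslate_neg_image i (-a) (A o)
    have h := hlink i A'
    rw [← htr i a A', ← htr i a (fun o => if cls i o then ssymP i 0 (A' o) else symP i 1 (A' o)),
      ← htr i a (fun o => if cls i o then ssymM i 0 (A' o) else symM i 1 (A' o))] at h
    have e0 : (fun o => (A' o).image (cellTranslate i a)) = A := funext hback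
    have e1 : (fun o => (if cls i o then ssymP i 0 (A' o) else symP i 1 (A' o)).image (cellTranslate i a)) =
        fun o => if cls i o then ssymP i (k - 1) (A o) else symP i k (A o) := by
      funext o
      split_ifs
      · rw [image_cellTranslate_ssymP, hback, zero_add]
      · rw [image_cellTranslate_symP, hback, ha, add_sub_cancel]
    have e2 : (fun o => (if cls i o then ssymM i 0 (A' o) else symM i 1 (A' o)).image (cellTranslate i a)) =
        fun o => if cls i o then ssymM i (k - 1) (A o) else symM i k (A o) := by
      funext o
      split_ifs
      · rw [image_cellTranslate_ssymM, hback, zero_add]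
      · rw [image_cellTranslate_symM, hback, ha, add_sub_cancel]
    rw [e0, e1, e2] at h
    exact h
  · -- SITE pair at `k` = translate by `k` of the SITE pair at `0`
    set A' : O → Finset (BlockIdx d N) := fun o => (A o).image (cellTranslate i (-k)) with hA'
    have hback : ∀ o, (A' o).image (cellTranslate i k) = A o := fun o => by
      rw [hA']; simpa using image_cellTranslate_neg_image i (-k) (A o)
    have h := hsite i A'
    rw [← htr i k A', ← htr i k (fun o => if cls i o then symP i 0 (A' o) else ssymP i 0 (A' o)),
      ← htr i k (fun o => if cls i o then symM i 0 (A' o) else ssymM i 0 (A' o))] at h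
    have e0 : (fun o => (A' o).image (cellTranslate i k)) = A := funext hback
    have e1 : (fun o => (if cls i o then symP i 0 (A' o) else ssymP i 0 (A' o)).image (cellTranslate i k)) =
        fun o => if cls i o then symP i k (A o) else ssymP i k (A o) := by
      funext o
      split_ifs
      · rw [image_cellTranslate_symP, hback, zero_add]
      · rw [image_cellTranslate_ssymP, hback, zero_add]
    have e2 : (fun o => (if cls i o then symM i 0 (A' o) else ssymM i 0 (A' o)).image (cellTranslate i k)) =
        fun o => if cls i o then symM i k (A o) else ssymM i k (A o) := by
      funext o
      split_ifs
      · rw [image_cellTranslate_symM, hback, zero_add]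
      · rw [image_cellTranslate_ssymM, hback, zero_add]
    rw [e0, e1, e2] at h
    exact h

end Main

end Summit.QuantumFields.YangMills.Theorems.AllSidesChessboard

end
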